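import Literature.Topology.FourManifolds.HalfDiscBundle
import Literature.Topology.FourManifolds.HalfPlaneAngle
import Literature.Topology.FourManifolds.GluingConstructionBoundary
import Literature.Topology.FourManifolds.RegularDomainMaps
import Literature.Topology.FourManifolds.ConnectedSumData
import Mathlib.Analysis.SpecialFunctions.Trigonometric.Deriv
import HarnessLib

/-!
# Kervaire–Milnor's rotation body (proof of Lemma 2.4 of *Groups of homotopy spheres I*, smooth half)

Topic `Literature/Topology/FourManifolds`. Kervaire–Milnor, *Groups of homotopy spheres I*,
Ann. of Math. 77 (1963), Lemma 2.4 (p. 507): "If `M` is a homotopy sphere, then `M # (-M)` bounds a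
contractible manifold." The printed proof constructs, from an imbedding `i : Dⁿ → M`, the
differentiable manifold `W` obtained from `(M - i(½D̊ⁿ)) × [0, π] + Sⁿ⁻¹ × H²` (`H²` the closed
half-disc of all `(t sin θ, t cos θ)`, `0 ≤ t ≤ 1`, `0 ≤ θ ≤ π`) by identifying `i(tu) × θ` with
`u × ((2t - 1) sin θ, (2t - 1) cos θ)` for `½ < t ≤ 1`, `0 ≤ θ ≤ π` — "intuitively we are removing
the interior of `i(½Dⁿ)` from `M` and then 'rotating' the result through 180° around the
resulting boundary".

This file constructs `W` (for any Hausdorff smooth `(m+1)`-manifold `M` and any chart `e` of `M`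
onto `ℝᵐ⁺¹`, `i = e⁻¹`) as a `C^∞` manifold with boundary modelled on `𝓡∂ (m + 2)`, by the tree's
gluing of manifolds with boundary (`GluingConstructionBoundary.lean`):

* the first piece is the cylinder `A = M' × [0, 1]` over the open submanifold
  `M' = M ∖ i(B̄(0, ½))` (`CylinderCobordism.lean`; the angle `θ = π s` is rescaled to
  `s ∈ [0, 1]`);
* the second piece is the half-disc bundle `B = Sᵐ × {(a, b) : a ≥ 0, a² + b² < 1}`
  (`HalfDiscBundle.lean`; the outer arc `a² + b² = 1` of `H²`, along which Kervaire–Milnor's two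
  pieces merely touch, is removed, so that no corners occur and the gluing is along *open*
  subsets);
* the gluing map `ψ : A ⊇ U → B`, `U = {(i(v), s) : ½ < ‖v‖ < 1}`, is Kervaire–Milnor's
  `ψ (i(v), s) = (v/‖v‖, (2‖v‖ - 1) (sin πs, cos πs))`, a diffeomorphism onto `B ∖ (Sᵐ × {0})`
  with inverse `(w, z) ↦ (i(((1 + ‖z‖)/2) w), θ(z)/π)`, `θ(z) ∈ [0, π]` the polar angle on the
  closed right half-plane (`HalfPlaneAngle.lean`).

Main results: `Literature.Topology.FourManifolds.RotationData` (the chart), `RotationData.glue` (the gluing partial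
diffeomorphism, `contMDiffOn_glue`, `contMDiffOn_glue_symm`), `RotationData.glueData`,
`RotationData.W` (the rotation body, a `C^∞` manifold with boundary), `t2Space_W`,
`compactSpace_W`, `secondCountableTopology_W`, and the description of the boundary
`RotationData.mem_boundary_W_iff` (`∂W = M' × {0, 1} ∪ Sᵐ × {a = 0}`). The identification of
`∂W` with `M # (-M)` and the deformation retraction of `W` onto `M - Int i(½Dⁿ)` are in the sibling
files `RotationBodyBoundary.lean`, `RotationBodyRetract.lean`.

## References

* M. Kervaire, J. Milnor, *Groups of homotopy spheres I*, Ann. of Math. (2) 77 (1963), 504–537,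
  Lemma 2.4 and its proof (p. 507). doi:10.2307/1970128 [KervaireMilnorAnnals1963]
* A. Kosinski, *Differential Manifolds*, Academic Press (1993), Ch. VI §1 (gluing). [Kosinski1993]
-/

open scoped Manifold ContDiff Topology
open Set Function Metric Real

noncomputable section

universe u

namespace Literature.Topology.FourManifolds

/-- Local notation: `𝔼 n` is the model Euclidean space `EuclideanSpace ℝ (Fin n)`. -/
local notation "𝔼 " n:arg => EuclideanSpace ℝ (Fin n)
/-- Local notation: `ℍ n` is the model half-space `EuclideanHalfSpace n`. -/
local notation "ℍ " n:arg => EuclideanHalfSpace n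
/-- Local notation: `𝕊 m` is the unit sphere in `EuclideanSpace ℝ (Fin (m + 1))`. -/
local notation "𝕊 " m:arg => (Metric.sphere (0 : EuclideanSpace ℝ (Fin (m + 1))) 1)

/-! ### Vectors of the plane `ℝ²` -/

namespace RotationBody

/-- The vector `(a, b)` of `ℝ² = EuclideanSpace ℝ (Fin 2)`. [folklore] -/
def E2 (a b : ℝ) : 𝔼 2 :=
  a • EuclideanSpace.single (0 : Fin 2) (1 : ℝ) + b • EuclideanSpace.single (1 : Fin 2) (1 : ℝ)

/-- The first coordinate of `E2 a b` is `a`. [folklore] -/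
@[simp] theorem E2_apply_zero (a b : ℝ) : E2 a b 0 = a := by
  simp [E2]

/-- The second coordinate of `E2 a b` is `b`. [folklore] -/
@[simp] theorem E2_apply_one (a b : ℝ) : E2 a b 1 = b := by
  simp [E2]

/-- Every vector of `ℝ²` is `(z 0, z 1)`. [folklore] -/
theorem E2_eta (z : 𝔼 2) : E2 (z 0) (z 1) = z := by
  ext j
  fin_cases j <;> simp

/-- The norm of a vector of `ℝ²`: `‖z‖ = √(z₀² + z₁²)`. [folklore] -/
theorem norm_two (z : 𝔼 2) : ‖z‖ = Real.sqrt (z 0 ^ 2 + z 1 ^ 2) := by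
  rw [EuclideanSpace.norm_eq, Fin.sum_univ_two]
  simp [sq_abs]

/-- `‖(a, b)‖ = √(a² + b²)`. [folklore] -/
theorem norm_E2 (a b : ℝ) : ‖E2 a b‖ = Real.sqrt (a ^ 2 + b ^ 2) := by
  rw [norm_two, E2_apply_zero, E2_apply_one]

/-- `(a, b) ↦ E2 a b` is smooth. [folklore] -/
theorem contDiff_E2 : ContDiff ℝ ∞ (fun p : ℝ × ℝ => E2 p.1 p.2) :=
  (contDiff_fst.smul contDiff_const).add (contDiff_snd.smul contDiff_const)

/-- `E2` is continuous in `(a, b)`. [folklore] -/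
theorem continuous_E2 : Continuous (fun p : ℝ × ℝ => E2 p.1 p.2) := contDiff_E2.continuous

/-- **The direction `(sin πs, cos πs)`** of Kervaire–Milnor's rotation at parameter `s ∈ [0, 1]`
(angle `θ = π s`). [cite: KervaireMilnorAnnals1963, Lemma 2.4, proof (p. 507)] -/
def rot (s : ℝ) : 𝔼 2 := E2 (Real.sin (π * s)) (Real.cos (π * s))

/-- The first coordinate of the direction is `sin πs`. [folklore] -/
@[simp] theorem rot_apply_zero (s : ℝ) : rot s 0 = Real.sin (π * s) := E2_apply_zero _ _

/-- The second coordinate of the direction is `cos πs`. [folklore] -/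
@[simp] theorem rot_apply_one (s : ℝ) : rot s 1 = Real.cos (π * s) := E2_apply_one _ _

/-- The direction is a unit vector. [folklore] -/
@[simp] theorem norm_rot (s : ℝ) : ‖rot s‖ = 1 := by
  rw [rot, norm_E2, Real.sin_sq_add_cos_sq, Real.sqrt_one]

/-- The direction is never zero. [folklore] -/
theorem rot_ne_zero (s : ℝ) : rot s ≠ 0 := by
  intro h; have := norm_rot s; rw [h, norm_zero] at this; exact zero_ne_one this

/-- At `s = 0` the direction is `(0, 1)`. [folklore] -/
@[simp] theorem rot_zero : rot 0 = E2 0 1 := by simp [rot]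

/-- At `s = 1` the direction is `(0, -1)`. [folklore] -/
@[simp] theorem rot_one : rot 1 = E2 0 (-1) := by simp [rot]

/-- `rot` is smooth. [folklore] -/
theorem contDiff_rot : ContDiff ℝ ∞ rot := by
  have h : ContDiff ℝ ∞ (fun s : ℝ => π * s) := contDiff_const.mul contDiff_id
  exact contDiff_E2.comp ((ContDiff.sin h).prodMk (ContDiff.cos h))

/-- `rot` is continuous. [folklore] -/
theorem continuous_rot : Continuous rot := contDiff_rot.continuous

/-- For `s ∈ [0, 1]` the first coordinate `sin πs` of the direction is nonnegative: the rotation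
stays in the closed right half-plane. [folklore] -/
theorem rot_apply_zero_nonneg {s : ℝ} (hs : s ∈ Icc (0 : ℝ) 1) : 0 ≤ rot s 0 := by
  rw [rot_apply_zero]
  exact Real.sin_nonneg_of_nonneg_of_le_pi (by nlinarith [hs.1, Real.pi_pos])
    (by nlinarith [hs.2, Real.pi_pos])

/-- The polar angle of `r • rot s` is `π s` (`r > 0`, `s ∈ [0, 1]`). [folklore] -/
theorem halfPlaneAngle_smul_rot {r s : ℝ} (hr : 0 < r) (hs : s ∈ Icc (0 : ℝ) 1) :
    halfPlaneAngle ((r • rot s) 0) ((r • rot s) 1) = π * s := by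
  have h1 : (r • rot s) 0 = r * Real.sin (π * s) := by simp
  have h2 : (r • rot s) 1 = r * Real.cos (π * s) := by simp
  rw [h1, h2]
  exact halfPlaneAngle_polar hr ⟨by nlinarith [hs.1, Real.pi_pos], by nlinarith [hs.2, Real.pi_pos]⟩

/-- Polar decomposition in the closed right half-plane: `z = ‖z‖ • rot (θ(z)/π)`. [folklore] -/
theorem norm_smul_rot_halfPlaneAngle {z : 𝔼 2} (hz : z ≠ 0) :
    ‖z‖ • rot (halfPlaneAngle (z 0) (z 1) / π) = z := by
  have hπ : π ≠ 0 := Real.pi_ne_zero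
  have h01 : z 0 ≠ 0 ∨ z 1 ≠ 0 := by
    by_contra h
    simp only [not_or, not_not] at h
    apply hz
    rw [← E2_eta z, h.1, h.2]
    ext j; fin_cases j <;> simp
  have hn : Real.sqrt (z 0 ^ 2 + z 1 ^ 2) = ‖z‖ := (norm_two z).symm
  have hn0 : ‖z‖ ≠ 0 := norm_ne_zero_iff.2 hz
  rw [rot, mul_div_cancel₀ _ hπ, sin_halfPlaneAngle h01, cos_halfPlaneAngle, hn]
  conv_rhs => rw [← E2_eta z]
  ext j
  fin_cases j <;> simp [E2] <;> field_simp

/-! ### Normalisation onto the sphere -/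

variable {m : ℕ}

/-- The normalisation `v/‖v‖`, extended by the junk value `e₀` at `v = 0`. [folklore] -/
def sphFun (v : 𝔼 (m + 1)) : 𝔼 (m + 1) :=
  if v = 0 then EuclideanSpace.single 0 1 else ‖v‖⁻¹ • v

/-- `sphFun` takes values in the unit sphere. [folklore] -/
theorem sphFun_mem (v : 𝔼 (m + 1)) : sphFun v ∈ sphere (0 : 𝔼 (m + 1)) 1 := by
  rw [mem_sphere_zero_iff_norm, sphFun]
  split_ifs with h
  · simp
  · rw [norm_smul, norm_inv, norm_norm, inv_mul_cancel₀ (norm_ne_zero_iff.2 h)]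

/-- **Normalisation onto the sphere** `v ↦ v/‖v‖ : ℝᵐ⁺¹ → Sᵐ` (junk value at `0`). [folklore] -/
def sphN (v : 𝔼 (m + 1)) : 𝕊 m := Set.codRestrict sphFun _ sphFun_mem v

/-- The underlying vector of `sphN v` is `v/‖v‖` for `v ≠ 0`. [folklore] -/
theorem coe_sphN {v : 𝔼 (m + 1)} (hv : v ≠ 0) : (sphN v : 𝔼 (m + 1)) = ‖v‖⁻¹ • v := by
  simp [sphN, sphFun, hv]

/-- Normalisation is invariant under positive rescaling. [folklore] -/
theorem sphN_smul {c : ℝ} (hc : 0 < c) {v : 𝔼 (m + 1)} (hv : v ≠ 0) : sphN (c • v) = sphN v := by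
  have hcv : c • v ≠ 0 := smul_ne_zero hc.ne' hv
  apply Subtype.ext
  rw [coe_sphN hcv, coe_sphN hv, norm_smul, Real.norm_eq_abs, abs_of_pos hc, smul_smul]
  congr 1
  field_simp

/-- A unit vector is its own normalisation. [folklore] -/
theorem sphN_coe (w : 𝕊 m) : sphN (w : 𝔼 (m + 1)) = w := by
  have hw : ‖(w : 𝔼 (m + 1))‖ = 1 := by simp
  have hw0 : (w : 𝔼 (m + 1)) ≠ 0 := by
    intro h; rw [h, norm_zero] at hw; exact zero_ne_one hw
  apply Subtype.ext
  rw [coe_sphN hw0, hw, inv_one, one_smul]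

/-- `‖v‖ • (v/‖v‖) = v`. [folklore] -/
theorem norm_smul_coe_sphN {v : 𝔼 (m + 1)} (hv : v ≠ 0) : ‖v‖ • (sphN v : 𝔼 (m + 1)) = v := by
  rw [coe_sphN hv, smul_smul, mul_inv_cancel₀ (norm_ne_zero_iff.2 hv), one_smul]

/-- `sphFun` is smooth off the origin. [folklore] -/
theorem contDiffOn_sphFun : ContDiffOn ℝ ∞ (sphFun : 𝔼 (m + 1) → 𝔼 (m + 1)) {v | v ≠ 0} := by
  have h : ContDiffOn ℝ ∞ (fun v : 𝔼 (m + 1) => ‖v‖⁻¹ • v) {v | v ≠ 0} := fun v hv =>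
    ((contDiffAt_norm ℝ hv).inv (norm_ne_zero_iff.2 hv)).contDiffWithinAt.smul
      contDiffWithinAt_id
  exact h.congr fun v hv => by simp [sphFun, show v ≠ 0 from hv]

/-- `sphFun` is continuous off the origin. [folklore] -/
theorem continuousOn_sphFun : ContinuousOn (sphFun : 𝔼 (m + 1) → 𝔼 (m + 1)) {v | v ≠ 0} :=
  contDiffOn_sphFun.continuousOn

end RotationBody

/-! ### Smooth maps into the sphere, local form -/

section Sphere

variable {F H : Type*} [NormedAddCommGroup F] [NormedSpace ℝ F] [TopologicalSpace H]
  {I : ModelWithCorners ℝ F H} {N : Type*} [TopologicalSpace N] [ChartedSpace H N]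
  [IsManifold I ∞ N] {E : Type*} [NormedAddCommGroup E] [InnerProductSpace ℝ E] {k : ℕ}
  [Fact (Module.finrank ℝ E = k + 1)]

/-- **A map into the sphere is smooth on an open set if it is smooth there as a vector-valued
map** (local form of Mathlib's `ContMDiff.codRestrict_sphere`, obtained by restricting to the
open submanifold). [folklore] -/
theorem contMDiffOn_codRestrict_sphere {f : N → E} {O : Set N} (hO : IsOpen O)
    (hf : ContMDiffOn I 𝓘(ℝ, E) ∞ f O) (hf' : ∀ x, f x ∈ sphere (0 : E) 1) :
    ContMDiffOn I (𝓡 k) ∞ (Set.codRestrict f _ hf') O := by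
  intro x hx
  set U : TopologicalSpace.Opens N := ⟨O, hO⟩
  have hg : ContMDiff I 𝓘(ℝ, E) ∞ (f ∘ (Subtype.val : U → N)) :=
    hf.comp_contMDiff contMDiff_subtype_val fun y => y.2
  have hg' : ContMDiff I (𝓡 k) ∞ (Set.codRestrict (f ∘ (Subtype.val : U → N)) _ fun y => hf' y.1) :=
    hg.codRestrict_sphere _
  have h2 : ContMDiffAt I (𝓡 k) ∞ (fun y : U => Set.codRestrict f _ hf' y.1) ⟨x, hx⟩ := hg' ⟨x, hx⟩
  exact (contMDiffAt_subtype_iff.1 h2).contMDiffWithinAt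

omit [InnerProductSpace ℝ E] [Fact (Module.finrank ℝ E = k + 1)] in
/-- A map into the sphere is continuous on a set if it is continuous there as a vector-valued
map. [folklore] -/
theorem continuousOn_codRestrict_sphere {X : Type*} [TopologicalSpace X] {f : X → E} {O : Set X}
    (hf : ContinuousOn f O) (hf' : ∀ x, f x ∈ sphere (0 : E) 1) :
    ContinuousOn (Set.codRestrict f _ hf') O :=
  Topology.IsInducing.subtypeVal.continuousOn_iff.2 hf

end Sphere

namespace RotationBody

variable {m : ℕ}

open scoped EuclideanSpace in
/-- `sphN` is smooth off the origin. [folklore] -/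
theorem contMDiffOn_sphN : ContMDiffOn 𝓘(ℝ, 𝔼 (m + 1)) (𝓡 m) ∞ (sphN : 𝔼 (m + 1) → 𝕊 m)
    {v | v ≠ 0} :=
  contMDiffOn_codRestrict_sphere isOpen_ne contDiffOn_sphFun.contMDiffOn sphFun_mem

/-- `sphN` is continuous off the origin. [folklore] -/
theorem continuousOn_sphN : ContinuousOn (sphN : 𝔼 (m + 1) → 𝕊 m) {v | v ≠ 0} :=
  continuousOn_codRestrict_sphere continuousOn_sphFun sphFun_mem

end RotationBody

/-! ### The data: a chart onto `ℝᵐ⁺¹` -/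

/-- **Rotation data** on a smooth `(m+1)`-manifold `M`: a chart `e` of the maximal `C^∞` atlas
whose target is all of `ℝᵐ⁺¹`, so that `i = e⁻¹ : ℝᵐ⁺¹ → M` is a smooth open disc — the
"imbedding `i`" from which Kervaire–Milnor form both `M # (-M)` (with `i₁ = i₂ = i`) and the
rotation body `W` (1963, proof of Lemma 2.4, p. 507). [cite: KervaireMilnorAnnals1963, Lemma 2.4, proof (p. 507)] -/
structure RotationData (m : ℕ) (M : Type u) [TopologicalSpace M] [ChartedSpace (𝔼 (m + 1)) M] where
  /-- a chart of `M` onto `ℝᵐ⁺¹` -/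
  e : OpenPartialHomeomorph M (𝔼 (m + 1))
  /-- the chart belongs to the maximal smooth atlas -/
  mem_maximalAtlas : e ∈ IsManifold.maximalAtlas (𝓡 (m + 1)) ∞ M
  /-- the chart is onto `ℝᵐ⁺¹` -/
  target_eq : e.target = univ

/-- Every nonempty smooth manifold carries rotation data (a maximal-atlas chart onto `ℝᵐ⁺¹`,
`exists_mem_maximalAtlas_target_eq_univ`). [folklore] -/
theorem nonempty_rotationData {m : ℕ} {M : Type u} [TopologicalSpace M] [ChartedSpace (𝔼 (m + 1)) M]
    [IsManifold (𝓡 (m + 1)) ∞ M] [Nonempty M] : Nonempty (RotationData m M) := by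
  obtain ⟨e, h, -, ht, -⟩ := exists_mem_maximalAtlas_target_eq_univ (E := 𝔼 (m + 1))
    (Classical.arbitrary M)
  exact ⟨⟨e, h, ht⟩⟩

namespace RotationData

variable {m : ℕ} {M : Type u} [TopologicalSpace M] [ChartedSpace (𝔼 (m + 1)) M]
  (R : RotationData m M)

/-- The connected sum data `(e, e)` of `M` with itself determined by rotation data: both discs
are `i = e⁻¹` (Kervaire–Milnor 1963, proof of Lemma 2.4: `M # (-M)` is formed with one disc `i`
on both sides). [cite: KervaireMilnorAnnals1963, Lemma 2.4, proof (p. 507)] -/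
def csd : ConnectedSumData (m + 1) M M :=
  ⟨R.e, R.e, R.mem_maximalAtlas, R.mem_maximalAtlas, R.target_eq, R.target_eq⟩

/-- The first chart of the connected sum data is `e`. [folklore] -/
@[simp] theorem csd_e₁ : R.csd.e₁ = R.e := rfl

/-- The second chart of the connected sum data is `e`. [folklore] -/
@[simp] theorem csd_e₂ : R.csd.e₂ = R.e := rfl

/-- The disc `i = e⁻¹ : ℝᵐ⁺¹ → M`. [cite: KervaireMilnorAnnals1963, Lemma 2.4, proof (p. 507)] -/
def i : 𝔼 (m + 1) → M := R.e.symm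

/-- `i = e⁻¹` (definitional). [folklore] -/
theorem i_def : R.i = R.e.symm := rfl

/-- The first disc of the connected sum data is `i`. [folklore] -/
@[simp] theorem csd_i₁ : R.csd.i₁ = R.i := rfl

/-- The second disc of the connected sum data is `i`. [folklore] -/
@[simp] theorem csd_i₂ : R.csd.i₂ = R.i := rfl

/-- The disc lands in the source of `e`. [folklore] -/
theorem i_mem (v : 𝔼 (m + 1)) : R.i v ∈ R.e.source := R.e.map_target (R.target_eq ▸ mem_univ v)

/-- `e ∘ i = id`. [folklore] -/
@[simp] theorem e_i (v : 𝔼 (m + 1)) : R.e (R.i v) = v := R.e.right_inv (R.target_eq ▸ mem_univ v)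

/-- `i ∘ e = id` on the source of `e`. [folklore] -/
theorem i_e {x : M} (hx : x ∈ R.e.source) : R.i (R.e x) = x := R.e.left_inv hx

/-- The disc is injective. [folklore] -/
theorem i_injective : Injective R.i := fun v w h => by
  rw [← R.e_i v, ← R.e_i w, h]

/-- The range of the disc is the source of `e`. [folklore] -/
theorem range_i : range R.i = R.e.source := by
  refine Subset.antisymm (by rintro _ ⟨v, rfl⟩; exact R.i_mem v) fun x hx => ⟨R.e x, R.i_e hx⟩

/-- A point of `e.source` is `i (e x)`; membership in an image of `i`. [folklore] -/
theorem mem_image_i_iff {x : M} {s : Set (𝔼 (m + 1))} :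
    x ∈ R.i '' s ↔ x ∈ R.e.source ∧ R.e x ∈ s := by
  constructor
  · rintro ⟨v, hv, rfl⟩; exact ⟨R.i_mem v, by rwa [R.e_i]⟩
  · rintro ⟨hx, hs⟩; exact ⟨R.e x, hs, R.i_e hx⟩

/-- The disc is continuous. [folklore] -/
theorem continuous_i : Continuous R.i := R.csd.continuous_i₁

/-- The disc is a smooth embedding. [folklore] -/
theorem isSmoothEmbedding_i : Manifold.IsSmoothEmbedding 𝓘(ℝ, 𝔼 (m + 1)) (𝓡 (m + 1)) ∞ R.i :=
  R.csd.isSmoothEmbedding_i₁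

/-- The disc is smooth. [folklore] -/
theorem contMDiff_i : ContMDiff 𝓘(ℝ, 𝔼 (m + 1)) (𝓡 (m + 1)) ∞ R.i := R.isSmoothEmbedding_i.contMDiff

/-- The chart is smooth on its source. [folklore] -/
theorem contMDiffOn_e : ContMDiffOn (𝓡 (m + 1)) 𝓘(ℝ, 𝔼 (m + 1)) ∞ R.e R.e.source :=
  contMDiffOn_of_mem_maximalAtlas R.mem_maximalAtlas

/-- The disc is an open embedding. [folklore] -/
theorem isOpenEmbedding_i : Topology.IsOpenEmbedding R.i :=
  ⟨R.isSmoothEmbedding_i.isEmbedding, by rw [R.range_i]; exact R.e.open_source⟩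

variable [T2Space M]

/-- The image of a closed ball under the disc is closed (it is compact). [folklore] -/
theorem isClosed_image_closedBall (r : ℝ) : IsClosed (R.i '' closedBall (0 : 𝔼 (m + 1)) r) :=
  ((isCompact_closedBall _ _).image R.continuous_i).isClosed

/-- **The open piece `M' = M ∖ i(B̄(0, ½))`** ("`M - i(½Dⁿ)`" with its boundary sphere removed), an
open submanifold of `M`. [cite: KervaireMilnorAnnals1963, Lemma 2.4, proof (p. 507)] -/
def M' : TopologicalSpace.Opens M :=
  ⟨(R.i '' closedBall (0 : 𝔼 (m + 1)) 2⁻¹)ᶜ, (R.isClosed_image_closedBall _).isOpen_compl⟩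

/-- Membership in `M'`. [folklore] -/
theorem mem_M'_iff {x : M} : x ∈ R.M' ↔ x ∉ R.i '' closedBall (0 : 𝔼 (m + 1)) 2⁻¹ := Iff.rfl

/-- A point of the coordinate patch lies in `M'` iff its coordinate has norm `> ½`. [folklore] -/
theorem mem_M'_iff_of_mem_source {x : M} (hx : x ∈ R.e.source) : x ∈ R.M' ↔ 2⁻¹ < ‖R.e x‖ := by
  rw [mem_M'_iff, R.mem_image_i_iff, mem_closedBall_zero_iff, not_and, not_le]
  exact ⟨fun h => h hx, fun h _ => h⟩

/-- `i v ∈ M' ↔ ½ < ‖v‖`. [folklore] -/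
theorem i_mem_M'_iff {v : 𝔼 (m + 1)} : R.i v ∈ R.M' ↔ 2⁻¹ < ‖v‖ := by
  rw [R.mem_M'_iff_of_mem_source (R.i_mem v), R.e_i]

/-- Points outside the coordinate patch lie in `M'`. [folklore] -/
theorem mem_M'_of_not_mem_source {x : M} (hx : x ∉ R.e.source) : x ∈ R.M' := fun h =>
  hx ((R.mem_image_i_iff.1 h).1)

/-- The point `i e₀` of `M'` (`‖e₀‖ = 1 > ½`), used as a junk value. [folklore] -/
def x₀ : R.M' :=
  ⟨R.i (EuclideanSpace.single 0 1), R.i_mem_M'_iff.2 (by rw [PiLp.norm_single, norm_one]; norm_num)⟩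

/-! ### The first piece -/

/-- **The first piece** `A = M' × [0, 1]`, the cylinder over `M' = M ∖ i(B̄(0, ½))` (a `C^∞`
manifold with boundary, `Cylinder.carrier`; Kervaire–Milnor's `(M - i(½Dⁿ)) × [0, π]` with the
sphere `i(½Sⁿ⁻¹) × [0, π]` removed and `θ = π s`). [cite: KervaireMilnorAnnals1963, Lemma 2.4, proof (p. 507)] -/
abbrev A : Type u := ↥(Cylinder.carrier (↥R.M'))

/-- The height of a point of the first piece lies in `[0, 1]`. [folklore] -/
theorem A_snd_mem (a : R.A) : a.1.2 ∈ Icc (0 : ℝ) 1 := Cylinder.mem_carrier_iff.1 a.2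

/-- The point `(x, s)` of the first piece, for `x ∈ M'`, `s ∈ [0, 1]`. [folklore] -/
def mkA (x : R.M') (s : ℝ) (hs : s ∈ Icc (0 : ℝ) 1) : R.A := ⟨(x, s), Cylinder.mem_carrier_iff.2 hs⟩

/-- The underlying pair of `mkA x s hs` is `(x, s)`. [folklore] -/
@[simp] theorem mkA_coe (x : R.M') (s : ℝ) (hs : s ∈ Icc (0 : ℝ) 1) : (R.mkA x s hs).1 = (x, s) := rfl

end RotationData

/-! ### The second piece -/

namespace RotationBody

variable (m : ℕ)

/-- **The second piece** `B = Sᵐ × {(a, b) : a ≥ 0, a² + b² < 1}`, the half-disc bundle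
(`HalfDiscBundle.carrier`; Kervaire–Milnor's `Sⁿ⁻¹ × H²` with the outer arc removed). [cite: KervaireMilnorAnnals1963, Lemma 2.4, proof (p. 507)] -/
abbrev B : Type := ↥(HalfDiscBundle.carrier m)

variable {m}

/-- The disc coordinate of a point of the second piece has norm `< 1`. [folklore] -/
theorem B_norm_lt (b : B m) : ‖(b.1.2 : 𝔼 2)‖ < 1 := HalfDiscBundle.mem_disc_iff.1 b.1.2.2

/-- The disc coordinate of a point of the second piece lies in the closed right half-plane.
[folklore] -/
theorem B_apply_zero_nonneg (b : B m) : 0 ≤ (b.1.2 : 𝔼 2) 0 := (HalfDiscBundle.mem_carrier_iff m).1 b.2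

/-- The sphere coordinate of a point of the second piece is a nonzero vector. [folklore] -/
theorem B_fst_ne_zero (b : B m) : (b.1.1 : 𝔼 (m + 1)) ≠ 0 := by
  intro h; have := mem_sphere_zero_iff_norm.1 b.1.1.2; rw [h, norm_zero] at this
  exact zero_ne_one this

/-- The point `(w, z)` of the second piece, for `w ∈ Sᵐ`, `‖z‖ < 1`, `z₀ ≥ 0`. [folklore] -/
def mkB (w : 𝕊 m) (z : 𝔼 2) (hz : ‖z‖ < 1) (hz0 : 0 ≤ z 0) : B m :=
  ⟨(w, ⟨z, HalfDiscBundle.mem_disc_iff.2 hz⟩), (HalfDiscBundle.mem_carrier_iff m).2 hz0⟩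

/-- The sphere coordinate of `mkB w z _ _` is `w`. [folklore] -/
@[simp] theorem mkB_coe_fst (w : 𝕊 m) (z : 𝔼 2) (hz : ‖z‖ < 1) (hz0 : 0 ≤ z 0) :
    (mkB w z hz hz0).1.1 = w := rfl

/-- The disc coordinate of `mkB w z _ _` is `z`. [folklore] -/
@[simp] theorem mkB_coe_snd (w : 𝕊 m) (z : 𝔼 2) (hz : ‖z‖ < 1) (hz0 : 0 ≤ z 0) :
    ((mkB w z hz hz0).1.2 : 𝔼 2) = z := rfl

/-- The junk point `(e₀, 0)` of the second piece. [folklore] -/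
def b₀ : B m := mkB ⟨EuclideanSpace.single 0 1, by simp⟩ 0 (by simp) (by simp)

/-- The target `B ∖ (Sᵐ × {0})` of the gluing map. [cite: KervaireMilnorAnnals1963, Lemma 2.4, proof (p. 507)] -/
def glueTarget : Set (B m) := {b | (b.1.2 : 𝔼 2) ≠ 0}

/-- Membership in the target of the gluing map: `z ≠ 0`. [folklore] -/
theorem mem_glueTarget_iff {b : B m} : b ∈ (glueTarget : Set (B m)) ↔ (b.1.2 : 𝔼 2) ≠ 0 := Iff.rfl

/-- The target of the gluing map is open. [folklore] -/
theorem isOpen_glueTarget : IsOpen (glueTarget : Set (B m)) :=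
  isOpen_ne.preimage (continuous_subtype_val.comp (continuous_snd.comp continuous_subtype_val))

/-- The radius `(1 + ‖z‖)/2 ∈ [½, 1)` at which the inverse gluing map re-enters the disc.
[folklore] -/
def invRadius (b : B m) : ℝ := (1 + ‖(b.1.2 : 𝔼 2)‖) / 2

/-- `(1 + ‖z‖)/2 < 1`. [folklore] -/
theorem invRadius_lt_one (b : B m) : invRadius b < 1 := by
  rw [invRadius]; linarith [B_norm_lt b]

/-- `½ ≤ (1 + ‖z‖)/2`. [folklore] -/
theorem half_le_invRadius (b : B m) : (2⁻¹ : ℝ) ≤ invRadius b := by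
  rw [invRadius]; have := norm_nonneg (b.1.2 : 𝔼 2); linarith

/-- `½ < (1 + ‖z‖)/2` on the target (`z ≠ 0`). [folklore] -/
theorem half_lt_invRadius_of_mem {b : B m} (hb : b ∈ (glueTarget : Set (B m))) :
    (2⁻¹ : ℝ) < invRadius b := by
  rw [invRadius]; have := norm_pos_iff.2 (mem_glueTarget_iff.1 hb); linarith

/-- `0 < (1 + ‖z‖)/2`. [folklore] -/
theorem invRadius_pos (b : B m) : 0 < invRadius b := lt_of_lt_of_le (by norm_num) (half_le_invRadius b)

/-- `‖((1 + ‖z‖)/2) w‖ = (1 + ‖z‖)/2` for a unit vector `w`. [folklore] -/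
theorem norm_invRadius_smul (b : B m) : ‖invRadius b • (b.1.1 : 𝔼 (m + 1))‖ = invRadius b := by
  rw [norm_smul, Real.norm_eq_abs, abs_of_pos (invRadius_pos b), mem_sphere_zero_iff_norm.1 b.1.1.2,
    mul_one]

/-- The angle coordinate `θ(z)/π ∈ [0, 1]` of the inverse gluing map. [folklore] -/
def invAngle (b : B m) : ℝ := halfPlaneAngle ((b.1.2 : 𝔼 2) 0) ((b.1.2 : 𝔼 2) 1) / π

/-- The angle coordinate lies in `[0, 1]`. [folklore] -/
theorem invAngle_mem (b : B m) : invAngle b ∈ Icc (0 : ℝ) 1 := by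
  have h := halfPlaneAngle_mem_Icc (b := (b.1.2 : 𝔼 2) 1) (B_apply_zero_nonneg b)
  rw [invAngle]
  constructor
  · exact div_nonneg h.1 Real.pi_pos.le
  · rw [div_le_one Real.pi_pos]; exact h.2

end RotationBody

namespace RotationData

open RotationBody

variable {m : ℕ} {M : Type u} [TopologicalSpace M] [ChartedSpace (𝔼 (m + 1)) M] [T2Space M]
  (R : RotationData m M)

attribute [local instance] Classical.propDecidable

/-! ### The gluing map and its inverse -/

/-- The source `U = {(x, s) : x ∈ i(B(0, 1))}` of the gluing map (then automatically
`½ < ‖e x‖ < 1`). [cite: KervaireMilnorAnnals1963, Lemma 2.4, proof (p. 507)] -/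
def glueSource : Set R.A := {a | (a.1.1 : M) ∈ R.e.source ∧ ‖R.e a.1.1‖ < 1}

/-- Membership in the source of the gluing map. [folklore] -/
theorem mem_glueSource_iff {a : R.A} :
    a ∈ R.glueSource ↔ (a.1.1 : M) ∈ R.e.source ∧ ‖R.e a.1.1‖ < 1 := Iff.rfl

/-- The source of the gluing map is open. [folklore] -/
theorem isOpen_glueSource : IsOpen R.glueSource := by
  have hc : Continuous fun a : R.A => (a.1.1 : M) :=
    continuous_subtype_val.comp (continuous_fst.comp continuous_subtype_val)
  have h := R.e.isOpen_inter_preimage (isOpen_ball (x := (0 : 𝔼 (m + 1))) (ε := 1))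
  convert h.preimage hc using 1
  ext a
  simp [glueSource]

/-- On the source of the gluing map, `½ < ‖e x‖`. [folklore] -/
theorem half_lt_norm_of_mem_glueSource {a : R.A} (ha : a ∈ R.glueSource) : 2⁻¹ < ‖R.e a.1.1‖ :=
  (R.mem_M'_iff_of_mem_source ha.1).1 a.1.1.2

/-- On the source of the gluing map, `0 < ‖e x‖`. [folklore] -/
theorem norm_pos_of_mem_glueSource {a : R.A} (ha : a ∈ R.glueSource) : 0 < ‖R.e a.1.1‖ :=
  lt_trans (by norm_num) (R.half_lt_norm_of_mem_glueSource ha)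

/-- On the source of the gluing map, `e x ≠ 0`. [folklore] -/
theorem e_ne_zero_of_mem_glueSource {a : R.A} (ha : a ∈ R.glueSource) : R.e a.1.1 ≠ 0 :=
  norm_pos_iff.1 (R.norm_pos_of_mem_glueSource ha)

/-- The radius `2‖e x‖ - 1 ∈ (0, 1)` on the source of the gluing map. [folklore] -/
theorem radius_mem_of_mem_glueSource {a : R.A} (ha : a ∈ R.glueSource) :
    2 * ‖R.e a.1.1‖ - 1 ∈ Ioo (0 : ℝ) 1 :=
  ⟨by linarith [R.half_lt_norm_of_mem_glueSource ha], by linarith [ha.2]⟩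

/-- The disc coordinate `(2‖e x‖ - 1) • (sin πs, cos πs)` of the gluing map, extended by `0` off
the source. [cite: KervaireMilnorAnnals1963, Lemma 2.4, proof (p. 507)] -/
def glueVec (a : R.A) : 𝔼 2 :=
  if a ∈ R.glueSource then (2 * ‖R.e a.1.1‖ - 1) • rot a.1.2 else 0

/-- The disc coordinate on the source is `(2‖e x‖ - 1) • rot s`. [folklore] -/
theorem glueVec_of_mem {a : R.A} (ha : a ∈ R.glueSource) :
    R.glueVec a = (2 * ‖R.e a.1.1‖ - 1) • rot a.1.2 := if_pos ha

/-- The disc coordinate on the source has norm `2‖e x‖ - 1`. [folklore] -/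
theorem norm_glueVec_of_mem {a : R.A} (ha : a ∈ R.glueSource) :
    ‖R.glueVec a‖ = 2 * ‖R.e a.1.1‖ - 1 := by
  rw [R.glueVec_of_mem ha, norm_smul, norm_rot, mul_one, Real.norm_eq_abs,
    abs_of_pos (R.radius_mem_of_mem_glueSource ha).1]

/-- The disc coordinate has norm `< 1`. [folklore] -/
theorem norm_glueVec_lt (a : R.A) : ‖R.glueVec a‖ < 1 := by
  by_cases ha : a ∈ R.glueSource
  · rw [R.norm_glueVec_of_mem ha]; exact (R.radius_mem_of_mem_glueSource ha).2
  · rw [glueVec, if_neg ha, norm_zero]; exact one_pos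

/-- The disc coordinate lies in the closed right half-plane. [folklore] -/
theorem glueVec_apply_zero_nonneg (a : R.A) : 0 ≤ R.glueVec a 0 := by
  by_cases ha : a ∈ R.glueSource
  · rw [R.glueVec_of_mem ha, PiLp.smul_apply, smul_eq_mul]
    exact mul_nonneg (R.radius_mem_of_mem_glueSource ha).1.le (rot_apply_zero_nonneg (R.A_snd_mem a))
  · rw [glueVec, if_neg ha]; rfl

/-- The disc coordinate on the source is nonzero. [folklore] -/
theorem glueVec_ne_zero_of_mem {a : R.A} (ha : a ∈ R.glueSource) : R.glueVec a ≠ 0 := by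
  rw [← norm_pos_iff, R.norm_glueVec_of_mem ha]; exact (R.radius_mem_of_mem_glueSource ha).1

/-- The sphere coordinate `e x/‖e x‖` of the gluing map (junk value off the source). [cite: KervaireMilnorAnnals1963, Lemma 2.4, proof (p. 507)] -/
def glueSph (a : R.A) : 𝕊 m := sphN (R.e a.1.1)

/-- **Kervaire–Milnor's gluing map** `ψ (i v, s) = (v/‖v‖, (2‖v‖ - 1) (sin πs, cos πs))` as a
total function `A → B` (junk values off the source `U`). [cite: KervaireMilnorAnnals1963, Lemma 2.4, proof (p. 507)] -/
def glueFun (a : R.A) : B m :=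
  mkB (R.glueSph a) (R.glueVec a) (R.norm_glueVec_lt a) (R.glueVec_apply_zero_nonneg a)

/-- The sphere coordinate of the gluing map. [folklore] -/
@[simp] theorem glueFun_coe_fst (a : R.A) : (R.glueFun a).1.1 = R.glueSph a := rfl

/-- The disc coordinate of the gluing map. [folklore] -/
@[simp] theorem glueFun_coe_snd (a : R.A) : ((R.glueFun a).1.2 : 𝔼 2) = R.glueVec a := rfl

/-- The point `i(((1 + ‖z‖)/2) w) ∈ M` of the inverse gluing map. [folklore] -/
def invPt (b : B m) : M := R.i (invRadius b • (b.1.1 : 𝔼 (m + 1)))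

omit [T2Space M] in
/-- The point of the inverse gluing map lies in the coordinate patch. [folklore] -/
theorem invPt_mem_source (b : B m) : R.invPt b ∈ R.e.source := R.i_mem _

omit [T2Space M] in
/-- The coordinate of the point of the inverse gluing map is `((1 + ‖z‖)/2) w`. [folklore] -/
@[simp] theorem e_invPt (b : B m) : R.e (R.invPt b) = invRadius b • (b.1.1 : 𝔼 (m + 1)) := R.e_i _

omit [T2Space M] in
/-- The coordinate of the point of the inverse gluing map has norm `(1 + ‖z‖)/2`. [folklore] -/
theorem norm_e_invPt (b : B m) : ‖R.e (R.invPt b)‖ = invRadius b := by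
  rw [R.e_invPt, norm_invRadius_smul]

/-- On the target, the point of the inverse gluing map lies in `M'`. [folklore] -/
theorem invPt_mem_M'_of_mem {b : B m} (hb : b ∈ (glueTarget : Set (B m))) : R.invPt b ∈ R.M' := by
  rw [invPt, R.i_mem_M'_iff, norm_invRadius_smul]; exact half_lt_invRadius_of_mem hb

/-- The `M'`-coordinate of the inverse gluing map (junk value `x₀` off the target). [folklore] -/
def invPtM' (b : B m) : R.M' :=
  if hb : b ∈ (glueTarget : Set (B m)) then ⟨R.invPt b, R.invPt_mem_M'_of_mem hb⟩ else R.x₀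

/-- On the target, the `M'`-coordinate of the inverse gluing map is `invPt`. [folklore] -/
theorem coe_invPtM'_of_mem {b : B m} (hb : b ∈ (glueTarget : Set (B m))) :
    (R.invPtM' b : M) = R.invPt b := by
  rw [invPtM', dif_pos hb]

/-- **The inverse gluing map** `(w, z) ↦ (i(((1 + ‖z‖)/2) w), θ(z)/π)` as a total function
`B → A`. [cite: KervaireMilnorAnnals1963, Lemma 2.4, proof (p. 507)] -/
def glueInv (b : B m) : R.A := R.mkA (R.invPtM' b) (invAngle b) (invAngle_mem b)

/-- The underlying pair of the inverse gluing map. [folklore] -/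
@[simp] theorem glueInv_coe (b : B m) : (R.glueInv b).1 = (R.invPtM' b, invAngle b) := rfl

/-! #### The two maps are mutually inverse -/

/-- The gluing map sends its source into the target. [folklore] -/
theorem glueFun_mem_target {a : R.A} (ha : a ∈ R.glueSource) :
    R.glueFun a ∈ (glueTarget : Set (B m)) :=
  R.glueVec_ne_zero_of_mem ha

/-- The inverse gluing map sends the target into the source. [folklore] -/
theorem glueInv_mem_source {b : B m} (hb : b ∈ (glueTarget : Set (B m))) :
    R.glueInv b ∈ R.glueSource := by
  refine ⟨?_, ?_⟩
  · show (R.invPtM' b : M) ∈ R.e.source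
    rw [R.coe_invPtM'_of_mem hb]; exact R.invPt_mem_source b
  · show ‖R.e (R.invPtM' b : M)‖ < 1
    rw [R.coe_invPtM'_of_mem hb, R.norm_e_invPt]; exact invRadius_lt_one b

/-- The inverse gluing map is a left inverse of the gluing map on the source. [folklore] -/
theorem glueInv_glueFun {a : R.A} (ha : a ∈ R.glueSource) : R.glueInv (R.glueFun a) = a := by
  have hb := R.glueFun_mem_target ha
  have hv0 := R.e_ne_zero_of_mem_glueSource ha
  have hr := R.radius_mem_of_mem_glueSource ha
  have hrad : invRadius (R.glueFun a) = ‖R.e a.1.1‖ := by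
    rw [invRadius, glueFun_coe_snd, R.norm_glueVec_of_mem ha]; ring
  have hpt : R.invPt (R.glueFun a) = (a.1.1 : M) := by
    rw [invPt, hrad, glueFun_coe_fst, glueSph, norm_smul_coe_sphN hv0, R.i_e ha.1]
  have hang : invAngle (R.glueFun a) = a.1.2 := by
    rw [invAngle, glueFun_coe_snd, R.glueVec_of_mem ha, halfPlaneAngle_smul_rot hr.1 (R.A_snd_mem a),
      mul_div_cancel_left₀ _ Real.pi_ne_zero]
  apply Subtype.ext
  rw [glueInv_coe]
  ext : 1
  · exact Subtype.ext (by rw [R.coe_invPtM'_of_mem hb, hpt])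
  · exact hang

/-- The gluing map is a left inverse of the inverse gluing map on the target. [folklore] -/
theorem glueFun_glueInv {b : B m} (hb : b ∈ (glueTarget : Set (B m))) : R.glueFun (R.glueInv b) = b := by
  have ha := R.glueInv_mem_source hb
  have hz : (b.1.2 : 𝔼 2) ≠ 0 := hb
  have hcoe : ((R.glueInv b).1.1 : M) = R.invPt b := R.coe_invPtM'_of_mem hb
  have he : R.e ((R.glueInv b).1.1 : M) = invRadius b • (b.1.1 : 𝔼 (m + 1)) := by
    rw [hcoe, R.e_invPt]
  have hsph : R.glueSph (R.glueInv b) = b.1.1 := by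
    rw [glueSph, he, sphN_smul (invRadius_pos b) (B_fst_ne_zero b), sphN_coe]
  have hvec : R.glueVec (R.glueInv b) = (b.1.2 : 𝔼 2) := by
    rw [R.glueVec_of_mem ha, he, norm_invRadius_smul, invRadius]
    have : (2 * ((1 + ‖(b.1.2 : 𝔼 2)‖) / 2) - 1) = ‖(b.1.2 : 𝔼 2)‖ := by ring
    rw [this]
    exact norm_smul_rot_halfPlaneAngle hz
  apply Subtype.ext
  ext : 1
  · exact hsph
  · exact Subtype.ext hvec

/-! #### Continuity -/

/-- The coordinate `a ↦ e x` is continuous on the source of the gluing map. [folklore] -/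
theorem continuousOn_e_fst : ContinuousOn (fun a : R.A => R.e a.1.1) R.glueSource :=
  R.e.continuousOn.comp (continuous_subtype_val.comp (continuous_fst.comp
    continuous_subtype_val)).continuousOn fun _ ha => ha.1

/-- The sphere coordinate of the gluing map is continuous on the source. [folklore] -/
theorem continuousOn_glueSph : ContinuousOn R.glueSph R.glueSource :=
  continuousOn_sphN.comp R.continuousOn_e_fst fun _ ha => R.e_ne_zero_of_mem_glueSource ha

/-- The disc coordinate of the gluing map is continuous on the source. [folklore] -/
theorem continuousOn_glueVec : ContinuousOn R.glueVec R.glueSource := by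
  have h : ContinuousOn (fun a : R.A => (2 * ‖R.e a.1.1‖ - 1) • rot a.1.2) R.glueSource :=
    ((continuousOn_const.mul R.continuousOn_e_fst.norm).sub continuousOn_const).smul
      (continuous_rot.comp (continuous_snd.comp continuous_subtype_val)).continuousOn
  exact h.congr fun a ha => R.glueVec_of_mem ha

/-- The gluing map is continuous on its source. [folklore] -/
theorem continuousOn_glueFun : ContinuousOn R.glueFun R.glueSource := by
  rw [Topology.IsInducing.subtypeVal.continuousOn_iff]
  refine R.continuousOn_glueSph.prodMk ?_
  rw [Topology.IsInducing.subtypeVal.continuousOn_iff]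
  exact R.continuousOn_glueVec

omit [T2Space M] in
/-- The radius of the inverse gluing map is continuous. [folklore] -/
theorem _root_.Literature.Topology.FourManifolds.RotationBody.continuous_invRadius : Continuous (invRadius : B m → ℝ) :=
  (continuous_const.add (continuous_subtype_val.comp (continuous_snd.comp
    continuous_subtype_val)).norm).div_const _

omit [T2Space M] in
/-- The point `invPt` of the inverse gluing map depends continuously on `b`. [folklore] -/
theorem continuous_invPt : Continuous R.invPt :=
  R.continuous_i.comp (continuous_invRadius.smul (continuous_subtype_val.comp
    (continuous_fst.comp continuous_subtype_val)))

/-- The `M'`-coordinate of the inverse gluing map is continuous on the target. [folklore] -/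
theorem continuousOn_invPtM' : ContinuousOn R.invPtM' (glueTarget : Set (B m)) := by
  rw [Topology.IsInducing.subtypeVal.continuousOn_iff]
  exact R.continuous_invPt.continuousOn.congr fun b hb => R.coe_invPtM'_of_mem hb

omit [T2Space M] in
/-- Off the origin, a point of the closed right half-plane has `z₀ > 0` or `z₁ ≠ 0`. [folklore] -/
theorem _root_.Literature.Topology.FourManifolds.RotationBody.pos_or_ne_zero_of_mem {b : B m} (hb : b ∈ (glueTarget : Set (B m))) :
    0 < (b.1.2 : 𝔼 2) 0 ∨ (b.1.2 : 𝔼 2) 1 ≠ 0 := by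
  by_contra h
  simp only [not_or, not_lt, not_not] at h
  have h0 : (b.1.2 : 𝔼 2) 0 = 0 := le_antisymm h.1 (B_apply_zero_nonneg b)
  apply mem_glueTarget_iff.1 hb
  rw [← E2_eta (b.1.2 : 𝔼 2), h0, h.2]
  ext j; fin_cases j <;> simp

omit [T2Space M] in
/-- The angle of the inverse gluing map is continuous on the target. [folklore] -/
theorem _root_.Literature.Topology.FourManifolds.RotationBody.continuousOn_invAngle :
    ContinuousOn (invAngle : B m → ℝ) (glueTarget : Set (B m)) := by
  intro b hb
  have hz : Continuous fun b : B m => (((b.1.2 : 𝔼 2) 0), ((b.1.2 : 𝔼 2) 1)) := by fun_prop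
  have h := (contDiffAt_halfPlaneAngle (p := ((b.1.2 : 𝔼 2) 0, (b.1.2 : 𝔼 2) 1)) (n := 0)
    (pos_or_ne_zero_of_mem hb)).continuousAt
  have h2 : ContinuousAt (fun b : B m => halfPlaneAngle ((b.1.2 : 𝔼 2) 0) ((b.1.2 : 𝔼 2) 1)) b :=
    ContinuousAt.comp (f := fun b : B m => (((b.1.2 : 𝔼 2) 0), ((b.1.2 : 𝔼 2) 1)))
      (g := fun q : ℝ × ℝ => halfPlaneAngle q.1 q.2) h hz.continuousAt
  exact (h2.div_const π).continuousWithinAt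

/-- The inverse gluing map is continuous on the target. [folklore] -/
theorem continuousOn_glueInv : ContinuousOn R.glueInv (glueTarget : Set (B m)) := by
  rw [Topology.IsInducing.subtypeVal.continuousOn_iff]
  exact R.continuousOn_invPtM'.prodMk continuousOn_invAngle

/-- **The gluing map as an open partial homeomorphism** `A ⊇ U ≅ B ∖ (Sᵐ × {0})`
(Kervaire–Milnor 1963, proof of Lemma 2.4). [cite: KervaireMilnorAnnals1963, Lemma 2.4, proof (p. 507)] -/
def glue : OpenPartialHomeomorph R.A (B m) where
  toFun := R.glueFun
  invFun := R.glueInv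
  source := R.glueSource
  target := glueTarget
  map_source' _ ha := R.glueFun_mem_target ha
  map_target' _ hb := R.glueInv_mem_source hb
  left_inv' _ ha := R.glueInv_glueFun ha
  right_inv' _ hb := R.glueFun_glueInv hb
  open_source := R.isOpen_glueSource
  open_target := isOpen_glueTarget
  continuousOn_toFun := R.continuousOn_glueFun
  continuousOn_invFun := R.continuousOn_glueInv

/-- The source of the gluing map (definitional). [folklore] -/
@[simp] theorem glue_source : R.glue.source = R.glueSource := rfl

/-- The target of the gluing map (definitional). [folklore] -/
@[simp] theorem glue_target : R.glue.target = glueTarget := rfl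

/-- The gluing map as a function (definitional). [folklore] -/
theorem glue_apply (a : R.A) : R.glue a = R.glueFun a := rfl

/-- The inverse of the gluing map as a function (definitional). [folklore] -/
theorem glue_symm_apply (b : B m) : R.glue.symm b = R.glueInv b := rfl

/-! #### Smoothness of the gluing map -/

variable [IsManifold (𝓡 (m + 1)) ∞ M]

/-- The inclusion of the first piece in `M' × ℝ` is smooth (product model). [folklore] -/
theorem contMDiff_val_A :
    ContMDiff (𝓡∂ (m + 2)) ((𝓡 (m + 1)).prod 𝓘(ℝ, ℝ)) ∞ (Subtype.val : R.A → ↥R.M' × ℝ) :=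
  Cylinder.contMDiff_subtype_val (m + 1) (↥R.M')

/-- The point of `M` under a point of the first piece depends smoothly on it. [folklore] -/
theorem contMDiff_A_pt : ContMDiff (𝓡∂ (m + 2)) (𝓡 (m + 1)) ∞ (fun a : R.A => (a.1.1 : M)) :=
  contMDiff_subtype_val.comp (contMDiff_fst.comp R.contMDiff_val_A)

/-- The height of a point of the first piece depends smoothly on it. [folklore] -/
theorem contMDiff_A_snd : ContMDiff (𝓡∂ (m + 2)) 𝓘(ℝ, ℝ) ∞ (fun a : R.A => a.1.2) :=
  contMDiff_snd.comp R.contMDiff_val_A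

/-- The coordinate `a ↦ e x` is smooth on the source of the gluing map. [folklore] -/
theorem contMDiffOn_e_A :
    ContMDiffOn (𝓡∂ (m + 2)) 𝓘(ℝ, 𝔼 (m + 1)) ∞ (fun a : R.A => R.e a.1.1) R.glueSource :=
  R.contMDiffOn_e.comp R.contMDiff_A_pt.contMDiffOn fun _ ha => ha.1

/-- The sphere coordinate of the gluing map is smooth on the source. [folklore] -/
theorem contMDiffOn_glueSph : ContMDiffOn (𝓡∂ (m + 2)) (𝓡 m) ∞ R.glueSph R.glueSource :=
  contMDiffOn_sphN.comp R.contMDiffOn_e_A fun _ ha => R.e_ne_zero_of_mem_glueSource ha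

omit [T2Space M] [IsManifold (𝓡 (m + 1)) ∞ M] in
/-- The Euclidean formula `(v, s) ↦ (2‖v‖ - 1) • rot s` is smooth off `v = 0`. [folklore] -/
theorem _root_.Literature.Topology.FourManifolds.RotationBody.contDiffAt_radius_smul_rot {q : 𝔼 (m + 1) × ℝ} (hq : q.1 ≠ 0) :
    ContDiffAt ℝ ∞ (fun q : 𝔼 (m + 1) × ℝ => (2 * ‖q.1‖ - 1) • rot q.2) q :=
  ((contDiffAt_const.mul ((contDiffAt_norm ℝ hq).comp q contDiffAt_fst)).sub
    contDiffAt_const).smul (contDiff_rot.contDiffAt.comp q contDiffAt_snd)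

/-- The disc coordinate of the gluing map is smooth on the source. [folklore] -/
theorem contMDiffOn_glueVec : ContMDiffOn (𝓡∂ (m + 2)) 𝓘(ℝ, 𝔼 2) ∞ R.glueVec R.glueSource := by
  have h1 : ContMDiffOn (𝓡∂ (m + 2)) 𝓘(ℝ, 𝔼 (m + 1) × ℝ) ∞ (fun a : R.A => (R.e a.1.1, a.1.2))
      R.glueSource := R.contMDiffOn_e_A.prodMk_space R.contMDiff_A_snd.contMDiffOn
  have h2 : ContMDiffOn (𝓡∂ (m + 2)) 𝓘(ℝ, 𝔼 2) ∞
      (fun a : R.A => (2 * ‖R.e a.1.1‖ - 1) • rot a.1.2) R.glueSource := fun a ha =>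
    (contDiffAt_radius_smul_rot (q := (R.e a.1.1, a.1.2))
      (R.e_ne_zero_of_mem_glueSource ha)).comp_contMDiffWithinAt
        (f := fun a : R.A => (R.e a.1.1, a.1.2)) (x := a) (h1 a ha)
  exact h2.congr fun a ha => R.glueVec_of_mem ha

/-- The gluing map, read in the ambient boundaryless manifold `Sᵐ × D` of the second piece
(product model), is smooth on the source. [folklore] -/
theorem contMDiffOn_val_glueFun : ContMDiffOn (𝓡∂ (m + 2)) ((𝓡 m).prod (𝓡 2)) ∞
    (fun a : R.A => (R.glueFun a).1) R.glueSource := by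
  refine R.contMDiffOn_glueSph.prodMk fun a ha => ?_
  rw [← ContMDiffWithinAt.subtypeVal_comp_iff]
  exact R.contMDiffOn_glueVec a ha

/-- **The gluing map is smooth on its source** (as a map between the manifolds with boundary
`A` and `B`): it is smooth into the ambient `Sᵐ × D` and takes values in the regular domain `B`
(`HalfSliceAtlas.contMDiffOn_codRestrict`). [cite: KervaireMilnorAnnals1963, Lemma 2.4, proof (p. 507)] -/
theorem contMDiffOn_glue : ContMDiffOn (𝓡∂ (m + 2)) (𝓡∂ (m + 2)) ∞ R.glue R.glue.source := by
  have h : ContMDiffOn (𝓡∂ (m + 2)) (HalfDiscBundle.model m) ∞ (fun a : R.A => (R.glueFun a).1)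
      R.glueSource := by
    rw [HalfDiscBundle.model, ContinuousLinearEquiv.contMDiffOn_transContinuousLinearEquiv_right]
    exact R.contMDiffOn_val_glueFun
  exact (HalfDiscBundle.atlas m).contMDiffOn_codRestrict (fun a => (R.glueFun a).2)
    R.isOpen_glueSource h

/-! #### Smoothness of the inverse gluing map -/

omit [T2Space M] [IsManifold (𝓡 (m + 1)) ∞ M] in
/-- The inclusion of the second piece in `Sᵐ × D` is smooth (product model). [folklore] -/
theorem _root_.Literature.Topology.FourManifolds.RotationBody.contMDiff_val_B :
    ContMDiff (𝓡∂ (m + 2)) ((𝓡 m).prod (𝓡 2)) ∞ (Subtype.val : B m → (𝕊 m) × ↥HalfDiscBundle.disc) :=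
  HalfDiscBundle.contMDiff_subtype_val m

open scoped EuclideanSpace in
omit [T2Space M] [IsManifold (𝓡 (m + 1)) ∞ M] in
/-- The sphere coordinate of the second piece, as a vector, is smooth. [folklore] -/
theorem _root_.Literature.Topology.FourManifolds.RotationBody.contMDiff_B_fst :
    ContMDiff (𝓡∂ (m + 2)) 𝓘(ℝ, 𝔼 (m + 1)) ∞ (fun b : B m => (b.1.1 : 𝔼 (m + 1))) :=
  contMDiff_coe_sphere.comp (contMDiff_fst.comp contMDiff_val_B)

omit [T2Space M] [IsManifold (𝓡 (m + 1)) ∞ M] in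
/-- The disc coordinate of the second piece, as a vector, is smooth. [folklore] -/
theorem _root_.Literature.Topology.FourManifolds.RotationBody.contMDiff_B_snd :
    ContMDiff (𝓡∂ (m + 2)) 𝓘(ℝ, 𝔼 2) ∞ (fun b : B m => (b.1.2 : 𝔼 2)) :=
  contMDiff_subtype_val.comp (contMDiff_snd.comp contMDiff_val_B)

omit [T2Space M] [IsManifold (𝓡 (m + 1)) ∞ M] in
/-- The pair of coordinates of the second piece, as vectors, is smooth. [folklore] -/
theorem _root_.Literature.Topology.FourManifolds.RotationBody.contMDiff_B_pair :
    ContMDiff (𝓡∂ (m + 2)) 𝓘(ℝ, 𝔼 (m + 1) × 𝔼 2) ∞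
      (fun b : B m => ((b.1.1 : 𝔼 (m + 1)), (b.1.2 : 𝔼 2))) :=
  contMDiff_B_fst.prodMk_space contMDiff_B_snd

omit [T2Space M] [IsManifold (𝓡 (m + 1)) ∞ M] in
/-- The Euclidean formula `(w, z) ↦ ((1 + ‖z‖)/2) • w` is smooth off `z = 0`. [folklore] -/
theorem _root_.Literature.Topology.FourManifolds.RotationBody.contDiffAt_invRadius_smul {q : 𝔼 (m + 1) × 𝔼 2} (hq : q.2 ≠ 0) :
    ContDiffAt ℝ ∞ (fun q : 𝔼 (m + 1) × 𝔼 2 => ((1 + ‖q.2‖) / 2) • q.1) q :=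
  ((contDiffAt_const.add ((contDiffAt_norm ℝ hq).comp q contDiffAt_snd)).div_const _).smul
    contDiffAt_fst

omit [T2Space M] [IsManifold (𝓡 (m + 1)) ∞ M] in
/-- The Euclidean formula `(w, z) ↦ θ(z)/π` is smooth at points with `z₀ > 0 ∨ z₁ ≠ 0`.
[folklore] -/
theorem _root_.Literature.Topology.FourManifolds.RotationBody.contDiffAt_angle {q : 𝔼 (m + 1) × 𝔼 2} (hq : 0 < q.2 0 ∨ q.2 1 ≠ 0) :
    ContDiffAt ℝ ∞ (fun q : 𝔼 (m + 1) × 𝔼 2 => halfPlaneAngle (q.2 0) (q.2 1) / π) q := by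
  have hl : ContDiff ℝ ∞ (fun q : 𝔼 (m + 1) × 𝔼 2 => (q.2 0, q.2 1)) := by
    have h0 : ContDiff ℝ ∞ (fun z : 𝔼 2 => z 0) :=
      (EuclideanSpace.proj (0 : Fin 2) : 𝔼 2 →L[ℝ] ℝ).contDiff
    have h1 : ContDiff ℝ ∞ (fun z : 𝔼 2 => z 1) :=
      (EuclideanSpace.proj (1 : Fin 2) : 𝔼 2 →L[ℝ] ℝ).contDiff
    exact (h0.comp contDiff_snd).prodMk (h1.comp contDiff_snd)
  exact ((contDiffAt_halfPlaneAngle (p := (q.2 0, q.2 1)) hq).comp q hl.contDiffAt).div_const _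

omit [T2Space M] [IsManifold (𝓡 (m + 1)) ∞ M] in
/-- The point `invPt` of the inverse gluing map depends smoothly on `b` on the target. [folklore] -/
theorem contMDiffOn_invPt : ContMDiffOn (𝓡∂ (m + 2)) (𝓡 (m + 1)) ∞ R.invPt (glueTarget : Set (B m)) := by
  have h : ContMDiffOn (𝓡∂ (m + 2)) 𝓘(ℝ, 𝔼 (m + 1)) ∞
      (fun b : B m => invRadius b • (b.1.1 : 𝔼 (m + 1))) (glueTarget : Set (B m)) := fun b hb =>
    (contDiffAt_invRadius_smul (q := ((b.1.1 : 𝔼 (m + 1)), (b.1.2 : 𝔼 2)))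
      (mem_glueTarget_iff.1 hb)).comp_contMDiffWithinAt
        (f := fun b : B m => ((b.1.1 : 𝔼 (m + 1)), (b.1.2 : 𝔼 2))) (x := b)
        (contMDiff_B_pair b).contMDiffWithinAt
  exact R.contMDiff_i.comp_contMDiffOn h

omit [IsManifold (𝓡 (m + 1)) ∞ M] in
/-- The `M'`-coordinate of the inverse gluing map is smooth on the target. [folklore] -/
theorem contMDiffOn_invPtM' :
    ContMDiffOn (𝓡∂ (m + 2)) (𝓡 (m + 1)) ∞ R.invPtM' (glueTarget : Set (B m)) := by
  intro b hb
  rw [← ContMDiffWithinAt.subtypeVal_comp_iff]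
  exact (R.contMDiffOn_invPt b hb).congr (fun b' hb' => R.coe_invPtM'_of_mem hb')
    (R.coe_invPtM'_of_mem hb)

omit [T2Space M] [IsManifold (𝓡 (m + 1)) ∞ M] in
/-- The angle of the inverse gluing map is smooth on the target. [folklore] -/
theorem _root_.Literature.Topology.FourManifolds.RotationBody.contMDiffOn_invAngle :
    ContMDiffOn (𝓡∂ (m + 2)) 𝓘(ℝ, ℝ) ∞ (invAngle : B m → ℝ) (glueTarget : Set (B m)) := fun b hb =>
  (contDiffAt_angle (q := ((b.1.1 : 𝔼 (m + 1)), (b.1.2 : 𝔼 2)))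
    (pos_or_ne_zero_of_mem hb)).comp_contMDiffWithinAt
      (f := fun b : B m => ((b.1.1 : 𝔼 (m + 1)), (b.1.2 : 𝔼 2))) (x := b)
      (contMDiff_B_pair b).contMDiffWithinAt

omit [IsManifold (𝓡 (m + 1)) ∞ M] in
/-- The inverse gluing map, read in the ambient boundaryless manifold `M' × ℝ` of the first
piece (product model), is smooth on the target. [folklore] -/
theorem contMDiffOn_val_glueInv : ContMDiffOn (𝓡∂ (m + 2)) ((𝓡 (m + 1)).prod 𝓘(ℝ, ℝ)) ∞
    (fun b : B m => (R.glueInv b).1) (glueTarget : Set (B m)) :=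
  R.contMDiffOn_invPtM'.prodMk contMDiffOn_invAngle

/-- **The inverse gluing map is smooth on the target** (as a map between the manifolds with
boundary `B` and `A`): smooth into the ambient `M' × ℝ` with values in the regular domain `A`
(`HalfSliceAtlas.contMDiffOn_codRestrict` for the cylinder's half-slice atlas). [cite: KervaireMilnorAnnals1963, Lemma 2.4, proof (p. 507)] -/
theorem contMDiffOn_glue_symm :
    ContMDiffOn (𝓡∂ (m + 2)) (𝓡∂ (m + 2)) ∞ R.glue.symm R.glue.target := by
  have h : ContMDiffOn (𝓡∂ (m + 2)) (Cylinder.model (m + 1)) ∞ (fun b : B m => (R.glueInv b).1)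
      (glueTarget : Set (B m)) := by
    rw [Cylinder.model, ContinuousLinearEquiv.contMDiffOn_transContinuousLinearEquiv_right]
    exact R.contMDiffOn_val_glueInv
  exact (Cylinder.atlas (m + 1) (↥R.M')).contMDiffOn_codRestrict (fun b => (R.glueInv b).2)
    isOpen_glueTarget h

/-! ### The gluing datum and the rotation body -/

/-- **The gluing datum of the rotation body**: the pieces `A = M' × [0, 1]` and
`B = Sᵐ × {a ≥ 0, a² + b² < 1}` glued along Kervaire–Milnor's `ψ` (1963, proof of Lemma 2.4,
p. 507). [cite: KervaireMilnorAnnals1963, Lemma 2.4, proof (p. 507)] -/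
def glueData : SmoothGlueData (𝓡∂ (m + 2)) (𝓡∂ (m + 2)) R.A (B m) (𝔼 (m + 2)) :=
  ⟨R.glue, R.contMDiffOn_glue, R.contMDiffOn_glue_symm, ContinuousLinearEquiv.refl ℝ _,
    ContinuousLinearEquiv.refl ℝ _⟩

/-- The gluing map of the gluing datum is `glue` (definitional). [folklore] -/
@[simp] theorem glueData_glue : R.glueData.glue = R.glue := rfl

/-- **Kervaire–Milnor's rotation body** `W = (M - i(½D̊ⁿ)) × [0, π] ∪_ψ Sⁿ⁻¹ × H²`, a `C^∞`
manifold with boundary modelled on `𝓡∂ (m + 2)` (instances `SmoothGlueData.instChartedSpaceH`,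
`instIsManifoldH`). [cite: KervaireMilnorAnnals1963, Lemma 2.4, proof (p. 507)] -/
abbrev W : Type u := R.glueData.Glued

/-! ### Separation, compactness, countability -/

omit [IsManifold (𝓡 (m + 1)) ∞ M] in
/-- **The rotation body is Hausdorff**: the graph of the gluing map is closed in `A × B`, being
cut out by the closed conditions `x = i(((1 + ‖z‖)/2) w)` and `z = ‖z‖ • rot s`
(`SmoothGlueData.t2Space_of_isClosed_graph`). [folklore] -/
theorem isClosed_graph_glue :
    IsClosed {p : R.A × B m | p.1 ∈ R.glue.source ∧ R.glue p.1 = p.2} := by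
  have heq : {p : R.A × B m | p.1 ∈ R.glue.source ∧ R.glue p.1 = p.2} =
      {p : R.A × B m | (p.1.1.1 : M) = R.invPt p.2 ∧
        (p.2.1.2 : 𝔼 2) = ‖(p.2.1.2 : 𝔼 2)‖ • rot p.1.1.2} := by
    ext ⟨a, b⟩
    simp only [mem_setOf_eq, glue_source, glue_apply]
    constructor
    · rintro ⟨ha, rfl⟩
      have hv0 := R.e_ne_zero_of_mem_glueSource ha
      refine ⟨?_, ?_⟩
      · have hrad : invRadius (R.glueFun a) = ‖R.e a.1.1‖ := by
          rw [invRadius, glueFun_coe_snd, R.norm_glueVec_of_mem ha]; ring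
        rw [invPt, hrad, glueFun_coe_fst, glueSph, norm_smul_coe_sphN hv0, R.i_e ha.1]
      · show R.glueVec a = ‖R.glueVec a‖ • rot a.1.2
        rw [R.norm_glueVec_of_mem ha, R.glueVec_of_mem ha]
    · rintro ⟨hx, hz⟩
      have hxs : (a.1.1 : M) ∈ R.e.source := by rw [hx]; exact R.invPt_mem_source b
      have hex : R.e a.1.1 = invRadius b • (b.1.1 : 𝔼 (m + 1)) := by rw [hx, R.e_invPt]
      have hnorm : ‖R.e a.1.1‖ = invRadius b := by rw [hex, norm_invRadius_smul]
      have hM' : (2⁻¹ : ℝ) < invRadius b := hnorm ▸ (R.mem_M'_iff_of_mem_source hxs).1 a.1.1.2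
      have hb : b ∈ (glueTarget : Set (B m)) := by
        rw [mem_glueTarget_iff, ← norm_pos_iff]
        rw [invRadius] at hM'
        linarith
      have ha : a ∈ R.glueSource := ⟨hxs, by rw [hnorm]; exact invRadius_lt_one b⟩
      refine ⟨ha, ?_⟩
      have hsph : R.glueSph a = b.1.1 := by
        rw [glueSph, hex, sphN_smul (invRadius_pos b) (B_fst_ne_zero b), sphN_coe]
      have hvec : R.glueVec a = (b.1.2 : 𝔼 2) := by
        rw [R.glueVec_of_mem ha, hnorm, invRadius]
        have : (2 * ((1 + ‖(b.1.2 : 𝔼 2)‖) / 2) - 1) = ‖(b.1.2 : 𝔼 2)‖ := by ring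
        rw [this, ← hz]
      apply Subtype.ext
      ext : 1
      · exact hsph
      · exact Subtype.ext hvec
  rw [heq]
  have h1 : Continuous fun p : R.A × B m => (p.1.1.1 : M) :=
    continuous_subtype_val.comp (continuous_fst.comp (continuous_subtype_val.comp continuous_fst))
  have h2 : Continuous fun p : R.A × B m => R.invPt p.2 := R.continuous_invPt.comp continuous_snd
  have h3 : Continuous fun p : R.A × B m => (p.2.1.2 : 𝔼 2) :=
    continuous_subtype_val.comp (continuous_snd.comp (continuous_subtype_val.comp continuous_snd))
  have h4 : Continuous fun p : R.A × B m => ‖(p.2.1.2 : 𝔼 2)‖ • rot p.1.1.2 :=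
    h3.norm.smul (continuous_rot.comp (continuous_snd.comp (continuous_subtype_val.comp
      continuous_fst)))
  exact (isClosed_eq h1 h2).inter (isClosed_eq h3 h4)

/-- The rotation body is Hausdorff. [folklore] -/
instance t2Space_W : T2Space R.W := R.glueData.t2Space_of_isClosed_graph R.isClosed_graph_glue

/-- The compact piece `K_A = (M ∖ i(B(0, ¾))) × [0, 1]` of the first piece. [folklore] -/
def KA : Set R.A := {a | (a.1.1 : M) ∉ R.i '' ball (0 : 𝔼 (m + 1)) (3 / 4)}

/-- The compact piece `K_B = Sᵐ × {‖z‖ ≤ ½}` of the second piece. [folklore] -/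
def _root_.Literature.Topology.FourManifolds.RotationBody.KB : Set (B m) := {b | ‖(b.1.2 : 𝔼 2)‖ ≤ 2⁻¹}

omit [IsManifold (𝓡 (m + 1)) ∞ M] in
/-- `K_A` is compact when `M` is. [folklore] -/
theorem isCompact_KA [CompactSpace M] : IsCompact R.KA := by
  -- read `K_A` in `M × ℝ` through the embedding `a ↦ (x, s)`
  set j : R.A → M × ℝ := fun a => ((a.1.1 : M), a.1.2) with hj
  have hjind : Topology.IsInducing j := by
    have h1 : Topology.IsInducing (fun p : ↥R.M' × ℝ => ((p.1 : M), p.2)) :=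
      Topology.IsInducing.subtypeVal.prodMap Topology.IsInducing.id
    exact h1.comp Topology.IsInducing.subtypeVal
  have himg : j '' R.KA = (R.i '' ball (0 : 𝔼 (m + 1)) (3 / 4))ᶜ ×ˢ Icc (0 : ℝ) 1 := by
    ext ⟨x, s⟩
    simp only [mem_image, mem_prod, mem_compl_iff, hj, Prod.mk.injEq]
    constructor
    · rintro ⟨a, ha, rfl, rfl⟩
      exact ⟨ha, R.A_snd_mem a⟩
    · rintro ⟨hx, hs⟩
      have hxM' : x ∈ R.M' := fun h => hx (image_mono (closedBall_subset_ball (by norm_num)) h)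
      exact ⟨R.mkA ⟨x, hxM'⟩ s hs, hx, rfl, rfl⟩
  rw [hjind.isCompact_iff, himg]
  exact ((R.isOpenEmbedding_i.isOpenMap _ isOpen_ball).isClosed_compl.isCompact).prod isCompact_Icc

omit [T2Space M] [IsManifold (𝓡 (m + 1)) ∞ M] in
/-- `K_B` is compact. [folklore] -/
theorem _root_.Literature.Topology.FourManifolds.RotationBody.isCompact_KB : IsCompact (KB : Set (B m)) := by
  set j : B m → 𝔼 (m + 1) × 𝔼 2 := fun b => ((b.1.1 : 𝔼 (m + 1)), (b.1.2 : 𝔼 2)) with hj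
  have hjind : Topology.IsInducing j := by
    have h1 : Topology.IsInducing (fun p : (𝕊 m) × ↥HalfDiscBundle.disc =>
        ((p.1 : 𝔼 (m + 1)), (p.2 : 𝔼 2))) :=
      Topology.IsInducing.subtypeVal.prodMap Topology.IsInducing.subtypeVal
    exact h1.comp Topology.IsInducing.subtypeVal
  have himg : j '' KB = sphere (0 : 𝔼 (m + 1)) 1 ×ˢ (closedBall (0 : 𝔼 2) 2⁻¹ ∩ {z | 0 ≤ z 0}) := by
    ext ⟨w, z⟩
    simp only [mem_image, mem_prod, mem_inter_iff, mem_closedBall_zero_iff, mem_setOf_eq, hj,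
      Prod.mk.injEq, KB]
    constructor
    · rintro ⟨b, hb, rfl, rfl⟩
      exact ⟨b.1.1.2, hb, B_apply_zero_nonneg b⟩
    · rintro ⟨hw, hz, hz0⟩
      exact ⟨mkB ⟨w, hw⟩ z (by linarith) hz0, hz, rfl, rfl⟩
  rw [hjind.isCompact_iff, himg]
  exact (isCompact_sphere _ _).prod ((isCompact_closedBall _ _).inter_right
    (isClosed_le continuous_const ((EuclideanSpace.proj (0 : Fin 2) : 𝔼 2 →L[ℝ] ℝ).continuous)))

/-- **The rotation body is compact** when `M` is: it is covered by the images of the compact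
sets `K_A = (M ∖ i(B(0, ¾))) × [0, 1]` and `K_B = Sᵐ × {‖z‖ ≤ ½}`. [folklore] -/
instance compactSpace_W [CompactSpace M] : CompactSpace R.W := by
  refine R.glueData.compactSpace_of_forall_not_mem R.isCompact_KA isCompact_KB ?_ ?_
  · intro a ha
    simp only [KA, mem_setOf_eq, not_not, R.mem_image_i_iff, mem_ball_zero_iff] at ha
    have has : a ∈ R.glueSource := ⟨ha.1, by linarith [ha.2]⟩
    refine ⟨has, ?_⟩
    show ‖R.glueVec a‖ ≤ 2⁻¹
    rw [R.norm_glueVec_of_mem has]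
    linarith [ha.2]
  · intro b hb
    simp only [KB, mem_setOf_eq, not_le] at hb
    have hbt : b ∈ (glueTarget : Set (B m)) := by
      rw [mem_glueTarget_iff, ← norm_pos_iff]; linarith
    refine ⟨hbt, ?_⟩
    show ((R.glueInv b).1.1 : M) ∉ R.i '' ball (0 : 𝔼 (m + 1)) (3 / 4)
    rw [glueInv_coe, R.coe_invPtM'_of_mem hbt, R.mem_image_i_iff, mem_ball_zero_iff, R.norm_e_invPt,
      invRadius]
    intro h
    linarith [h.2]

/-- The rotation body is second countable when `M` is compact. [folklore] -/
instance secondCountableTopology_W [CompactSpace M] : SecondCountableTopology R.W :=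
  R.glueData.secondCountableTopologyH

/-! ### The boundary of the rotation body -/

/-- A point `inl (x, s)` of the rotation body is a boundary point iff `s = 0 ∨ s = 1` (the two
faces of the cylinder). [folklore] -/
theorem isBoundaryPoint_inl_iff (a : R.A) :
    (𝓡∂ (m + 2)).IsBoundaryPoint (R.glueData.inl a) ↔ a.1.2 = 0 ∨ a.1.2 = 1 := by
  rw [R.glueData.isBoundaryPoint_inl_iff, Cylinder.isBoundaryPoint_iff]

/-- A point `inr (w, z)` of the rotation body is a boundary point iff `z₀ = 0` (the diameter of
the half-disc). [folklore] -/
theorem isBoundaryPoint_inr_iff (b : B m) :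
    (𝓡∂ (m + 2)).IsBoundaryPoint (R.glueData.inr b) ↔ (b.1.2 : 𝔼 2) 0 = 0 := by
  rw [R.glueData.isBoundaryPoint_inr_iff, HalfDiscBundle.isBoundaryPoint_iff]

/-- **The boundary of the rotation body** is `M' × {0, 1} ∪ Sᵐ × {z₀ = 0}`: the two copies of
`M - i(½D̊ⁿ)` (faces `s = 0` and `s = 1`) and the diameter of the half-disc bundle, whose two
halves `z₁ > 0`, `z₁ < 0` are glued to the two faces over `i({½ < ‖v‖ < 1})` and whose core
`Sᵐ × {0}` joins them (Kervaire–Milnor 1963, p. 507: "`bW = M # (-M)`").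
[cite: KervaireMilnorAnnals1963, Lemma 2.4, proof (p. 507)] -/
theorem boundary_W_eq : (𝓡∂ (m + 2)).boundary R.W =
    R.glueData.inl '' {a | a.1.2 = 0 ∨ a.1.2 = 1} ∪ R.glueData.inr '' {b | (b.1.2 : 𝔼 2) 0 = 0} := by
  rw [R.glueData.boundary_glued_eq]
  congr 1
  · congr 1; ext a; exact Cylinder.isBoundaryPoint_iff (m + 1) (↥R.M') a
  · congr 1; ext b; exact HalfDiscBundle.isBoundaryPoint_iff m b

end RotationData

end Literature.Topology.FourManifolds
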